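import Mathlib
import HarnessLib
import HarnessLib.Audit
import Summits.AtomisticToContinuum.Statement
import Literature.MathematicalPhysics.QuantumManyBody.PeriodicBoseGas
import HarnessLib.Audit.Status.Attr

/-!
Route: BECPeriodDoubling

DORMANT since 2026-08-29T19:28:32Z (census g0: costume|duplicate of —; reader census-reader-32-g0) — unstaffed, not closed; items shared with open routes are served there. `ledger route dormant <id> --off` reactivates.

# Route BECPeriodDoubling — finite tori over-condense — period doubling of the torus is monotone, so
thermodynamic-limit BEC reduces to fixed-range order after the limit

It suffices to show X = TorusUnfolding ∧ FixedRangeOrder for the periodic (torus) problem, plus the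
shared boundary-condition
transfer BoundaryTransferWeak (stmt-AtomisticToContinuum-0827). Write G_Ψ(i,r) := ∫_{cell^N} conj
Ψ(X with X_i ↦ X_i + r)·Ψ(X) dX
for a periodic trial state Ψ on the torus of side L (G(i,0) = 1, |G| ≤ 1, γ̄_Ψ(r) = ρ·G is the
translation-averaged one-body
density matrix, n₀(Ψ) = (N/L³)∫_cell G). TorusUnfolding (card torus-unfolding-monotone V1, CENTRED
CELL): at fixed density, for all
large N, near-minimisers Φ on the torus of side L_{8N} = 2L_N and Ψ on the torus of side L_N satisfy
Re G_Φ(j,r) ≤ Re G_Ψ(i,r) + ε for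
every displacement r in the closed centred cell ‖r‖∞ ≤ L_N/2 — unfolding the period can only lose
coherence. FixedRangeOrder (card V3,
infinite-volume ODLRO without a limit object): ∃σ>0 such that for every range R, eventually in N,
near-minimisers have Re G ≥ σ − ε on
‖r‖ ≤ R. Iterating V1 along M_{j+1} = 8M_j turns "thermodynamic limit first, then r → ∞" into "the
whole cell at every large N":
Re G_N ≥ σ/2 on the centred cell, hence n₀ ≥ (σ/2)N (CellCoherence), i.e. the PeriodicBEC body of
stmt-0826, and
BoundaryTransferWeak gives the Dirichlet conjunct. Conforming re-opening (g2) of the retired route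
BECTorusUnfolding (same card).
Lean: `TorusUnfolding ∧ FixedRangeOrder`

## Assembly
Pure logic (rc 0 in Sketch.lean; axioms propext / Classical.choice / Quot.sound): fix v repulsive
finite-range; UnfoldingToPeriodicBEC
applied to TorusUnfolding, FixedRangeOrder and CellCoherence yields the PeriodicBEC body for v;
BoundaryTransferWeak turns it into
∃ρ₀ ∀ρ<ρ₀ HasGroundStateBEC v ρ, i.e. the sub-problem Statement decl `BoseEinsteinCondensation`
(root abbrev of the Literature
conjecture). Deciding theorem (glue.lean): `theorem closes (h1 : TorusUnfolding) (h2 :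
FixedRangeOrder) (h3 : CellCoherence)
(h4 : UnfoldingToPeriodicBEC) (h5 : BoundaryTransferWeak) : BoseEinsteinCondensation := fun v hv =>
h5 v hv (h4 h1 h2 h3 v hv)`.

Rationale: WHY THIS LINE. Mechanism: a one-signed comparison in the DOMAIN (the period of the torus) replaces
every rate/gap estimate. With the sum rule,
1 − G_{N,L}(r) = N⁻¹Σ_{k≠0} n_k(1 − cos k·r) is a Riemann sum (mesh 2π/L) of the nonnegative
integrand n(k)(1 − cos k·r), and
period doubling refines the mesh to π/L; for a smooth integrand the two sums agree to all orders in
1/L, so the entire difference is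
the infrared singularity n(k) ≃ mc/(2ħ|k|) of the T = 0 momentum distribution (GavoretNozieres1964;
Bogoliubov), whose Poisson-summed
form is the image second-difference Σ_{m≠0}[½γ₁(Lm+r)+½γ₁(Lm−r)−γ₁(Lm)] of the subharmonic tail
γ₁(x) ≃ mc/(4π²ħx²): positive on the
whole centred cell in d = 3 (cubic symmetry turns the directional second difference into ⅓ of a
Laplacian sum at small r; lattice sums
of the card/gen-0: +0.05, +0.38, +2.4 ×A/L² at 0.1L, L/4, L/2), and the O(1/N) pair-count correction
(n_k ∝ N(N−1) at second order,
so depletion per particle ∝ 1 − 1/N) pushes the same way and dominates at small r. This is the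
continuum-boson form of the finite-size
lore that broken-continuous-symmetry ground states over-order on periodic boxes
(HasenfratzNiedermayer1993; quasi-condensates
MoraCastin2003) and of domain monotonicity / method of images for positive kernels (Davies1989).
Imported areas: spectral geometry
(heat-kernel comparison, Poisson summation), finite-size (U(1)-conserving) Bogoliubov theory as
heuristic and falsifier, Penrose–Onsager
ODLRO (PenroseOnsager1956, LSSY2005 §1.2). What it does that the open routes do not: they fight
N-uniformity INSIDE one box (energy
windows pay the kinetic gap, Literature.Barriers.AtomisticToContinuum.KineticGapLengthScalesNarrow);
here N-uniformity is a comparison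
between two FINITE tori and what remains, FixedRangeOrder, is order at fixed distance after the
limit — the exactly stationary setting
where the infinite-volume cards (rigidity-tolerance, Palm landscape, insertion corrector, Rényi
delocalisation) act natively. Versus the
retired BECTorusUnfolding: the deciding theorem now concludes the Statement decl; V1 is restricted
to the centred cell (the old ∀r∈ℝ³
form silently added a radial-monotonicity claim for G_{8N,2L} between L_N/2 and L_N); the criterion
takes its hypothesis on the centred
cell only; the falsifier is sharpened (canonical, not ρ→ρ₀-substituted, finite-size Bogoliubov).
Negatives index: 1 BEC entry
(SwapJensen, an unguarded constant) — no contact.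

RANKED CRUXES. #2 TorusUnfolding (crux) — (card V1, centred cell) for every repulsive finite-range v
there is ρ₀>0 such that for 0<ρ<ρ₀, for all large N, for every ε>0 there is δ>0 with: for all
δ-near-minimisers Ψ of the periodic energy on the torus of side L_N=(N/ρ)^{1/3} and Φ on the torus
of side L_{8N} = 2L_N, all particles i, j and every displacement r with |r_k| ≤ L_N/2 (k=1,2,3), Re
G_Φ(j,r) ≤ Re G_Ψ(i,r) + ε (for unique ground states: γ̄_{8N,2L}(r) ≤ γ̄_{N,L}(r) on the closed
centred cell). Rank 2: the line-defining, cheaply testable claim; necessary consequences: kinetic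
energy per particle t_{8N}(ρ) ≥ t_N(ρ) eventually (r→0), condensate fraction f_{8N} ≤ f_N (cell
average). [difficulty: L] (why it might fail: Beyond the quadratic (Bogoliubov) level the occupation
of the lowest modes |k|=2π/L (n_k ~ L/ξ) has no proved finite-size sign; an O(1) relative shift
there cancels the O(γ₁(L)) image margin at ‖r‖ ~ L/2; 1D hard-rod numerics (N=2,3) reversed it at
the antipode.) [MoraCastin2003, HasenfratzNiedermayer1993, GavoretNozieres1964,
GiorginiBoronatCasulleras1999, Davies1989, PuleZagrebnov2004, LSSY2005,
doi:10.1016/j.physleta.2022.128515]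
#3 FixedRangeOrder (crux) — (card V3, typed without the limit state, Euclidean balls) for every
repulsive finite-range v there is ρ₀>0 such that for 0<ρ<ρ₀ there is σ>0 with: for every range R,
for all large N (threshold depending on R), for every ε>0 there is δ>0 such that every
δ-near-minimiser Ψ on the torus of side L_N satisfies σ ≤ Re G_Ψ(i,r) + ε for all particles i and
all r with ‖r‖ ≤ R — off-diagonal long-range order with the thermodynamic limit taken FIRST,
uniformly along the sequence (the residual open problem in its weakest order of limits; the entry
point for the infinite-volume cards). [difficulty: open-problem] (why it might fail: It is T=0
infinite-volume ODLRO for the interacting continuum gas — open; d=3 is infrared-marginal for any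
expansion (BogoliubovPerturbationInfrared), no printed method reaches fixed density
(KineticGapLengthScales), and σ must serve hard cores and every near-minimiser.) [LSSY2005,
PenroseOnsager1956, Fournais2020, Junge2026,
Literature.Barriers.AtomisticToContinuum.BogoliubovPerturbationInfrared,
Literature.Barriers.AtomisticToContinuum.KineticGapLengthScales]
#4 BoundaryTransferWeak (crux) — (shared verbatim with stmt-AtomisticToContinuum-0827, home route
BECPeriodicReduction, wanted by BECIroning/BECPhononFloor/BECLaplacianL1/BECStronglyRayleigh) for
each repulsive finite-range v, constant-mode BEC for periodic near-minimisers at all small densities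
(the PeriodicBEC body, δ after N) implies the conjunct's Dirichlet, mode-free HasGroundStateBEC v ρ
for all small ρ. [difficulty: L] (why it might fail: Dirichlet and periodic ground-state energies
differ by a wall term ≫ the near-minimiser slack, so no energy-comparison proof; Neumann bracketing
must re-localise without re-importing the ℓ⁻² gap; BEC is boundary-condition sensitive (Robinson,
Lauwers–Verbeure–Zagrebnov).) [LSSY2005, BoccatoSeiringer2023, Junge2026,
LauwersVerbeureZagrebnov2003, arXiv:2603.20776]
#9 CellCoherence (support) — for L>0, any N, s and any periodic trial state Ψ of N particles on the
torus of side L: a uniform bound s ≤ Re G_Ψ(i,r) for all particles i and all r in the closed CENTRED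
cell (|r_k| ≤ L/2) gives condensateOccupation N L Ψ ≥ s·N. Proof: n₀ =
N·L⁻³∫_{Y∈cell^{N−1}}|∫_{x∈cell}Ψ(x,Y)dx|² = (N/L³)∫_Y∫_{x∈cell}∫_{x'∈cell} conj Ψ(x',Y)Ψ(x,Y); by
Lℤ³-periodicity of Ψ in particle 0 the x'-integral over the cell equals the integral of conj
Ψ(x+r,Y) over r in ANY fundamental domain, take the centred cell C₀; Fubini gives n₀ =
(N/L³)∫_{r∈C₀} G_Ψ(0,r) dr (real), ≥ (N/L³)·L³·s. N = 0 and s ≤ 0 are trivial (ofReal). Positivity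
of Ψ is NOT needed. [difficulty: M] [LSSY2005, Fournais2020]
#9 UnfoldingToPeriodicBEC (support) — TorusUnfolding → FixedRangeOrder → CellCoherence →
[PeriodicBEC body, verbatim the antecedent of BoundaryTransferWeak / the signature of stmt-0826].
Proof (elementary bookkeeping): fix v, ρ < min(ρ₀^{TU}, ρ₀^{FRO}), σ from FixedRangeOrder, c := σ/2;
N ≥ max(N₀(TU),1); R := L_N (≥ (√3/2)L_N, the circumradius of the centred cell); FixedRangeOrder
gives N₁(R); levels M₀ := N, M_{j+1} := 8·M_j (definitional, no casts; sideLength monotone in N by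
Real.rpow_le_rpow, so the centred N-cell lies in every centred M_j-cell); pick k with M_k ≥ N₁; ε'
:= σ/(2(k+1)); δ* := min of the k TorusUnfolding δ's (levels M_0…M_{k−1}, tolerance ε') and the
FixedRangeOrder δ (level M_k, ε'); output δ := δ*. For a δ*-near-minimiser Ψ at level N choose
δ*-near-minimisers Φ_j at levels j = 1…k (the constant state inhabits PeriodicTrialState M L for L >
0; iInf_lt_iff if E₀ < ⊤, anything if E₀ = ⊤); chain Re G_Ψ ≥ Re G_{Φ_k} − kε' ≥ σ − (k+1)ε' = σ/2
on the centred N-cell; CellCoherence with s = σ/2. [difficulty: M] [LSSY2005, Fournais2020]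

TWO-LAYER PLAN. TorusUnfolding ⇐ ImageIdentity → RemainderBound → TorusUnfolding (ImageIdentity:
G_{N,L}(r) − G_{8N,2L}(r) = [image second-difference
sum of the big-torus tail over m ∉ 2ℤ³] + R_N(r); RemainderBound: |R_N(r)| ≤ half the image term
eventually — the finite-size shift of
the low-mode occupations in U(1)-conserving form), OR the path-space split PositiveBridge →
UnfoldingInequality → TorusUnfolding
(ground-state transform / Feynman–Kac representation of G by positive N-body bridge measures on the
torus, in-tree
GroundStateFeynmanKac* files; folding 2L → L keeps every path and adds the odd-winding images).
FixedRangeOrder ⇐ LimitCorrelations →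
LimitODLRO → FixedRangeOrder (tightness of near-minimiser correlations along the sequence; ODLRO of
the limit object — where the
Palm / Kipnis–Varadhan / rigidity cards plug in). BoundaryTransferWeak as planned at its home route
(Neumann bracketing + a mode-free
criterion λ_max ≥ tr γ²/N; arXiv:2603.20776 propagates condensation by Neumann localisation). k ≤ 3,
depth 1 each.

KILL CRITERIA. ¬TorusUnfolding with a witness on an open set of displacements of the centred cell at
arbitrarily large N and small ρ (e.g. a
U(1)-conserving finite-size Bogoliubov computation with the wrong sign made rigorous for some
admissible v): if the witness lives only
in an outer shell max_k|r_k| > θL/2, REPAIR by restating TorusUnfolding on the inner cube ‖r‖∞ ≤ L/4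
and adding the Perron–Frobenius
support item (near-minimisers have Re G ≥ −ε on the cell; then n₀ ≥ σN/16 − o(N)); if it lives at
small r (kinetic energy per particle
DEcreasing in N at fixed ρ, eventually) close the route `refuted:TorusUnfolding`. ¬FixedRangeOrder
for some admissible v at arbitrarily
small ρ refutes infinite-volume ODLRO — closes this route and, physically, the periodic form of the
conjunct (signal to all BEC
routes). ¬BoundaryTransferWeak kills this route and every 0827-consumer, not the conjunct.
PeriodicBEC (0826) proved elsewhere moots
ranks 2–3 (close `superseded`); BoundaryTransferWeak proved elsewhere just closes rank 4.

NOT DECOMPOSED YET. The card's V2 (Dilution3D: λ_max/N non-decreasing in L at fixed N in d=3,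
collapsing ∀ρ<ρ₀ to one density) is NOT filed: not
load-bearing here and its weak implication form is vacuously satisfiable as worded; candidate
support after 3D N=2 numerics. Also
layer 2: Perron–Frobenius positivity/uniqueness of the torus ground state (only needed after an
outer-shell repair; for hard cores it
needs connectivity of the hard-sphere configuration space on the torus at low density), existence of
exact C¹ minimisers (never used:
every statement is in ε–δ near-minimiser form), the value σ(ρ) = 1 − O(√(ρa³)), a general-M version
of unfolding (M ≥ N instead of
8N), the averaged fallback (cube averages of G instead of pointwise), Dirichlet/Neumann variants
(Dirichlet boxes UNDER-condense: wrong
direction), and any rate in N.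

CHEAPEST FALSIFIER. U(1)/number-conserving finite-size Bogoliubov theory on the cubic torus
(MoraCastin2003 / Castin–Dum type, CANONICAL density in μ):
sign of G_{N,L}(r) − G_{8N,2L}(r) over the centred cell at ρa³ ∈ [10⁻⁵,10⁻²], N = 10³…10⁶ (the
finite-size shift of n_k at |k| = 2π/L
against the image margin) and sign of t_{8N}(ρ) − t_N(ρ). Caveat found here by hand: substituting ρ
→ n₀(L)/V in μ gives a SPURIOUS
adverse O(a(ρa)²/L²) shift of the kinetic-energy density (the O(1/(ξL²)) over-condensation of a
finite torus is an infrared phase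
effect; local observables carry only the O(L⁻³) pair-count and O(L⁻⁴) phonon-Casimir terms) and
would wrongly "refute" V1 near r = 0 —
the check must be canonical. Frozen-occupation level (card + gen-0 lattice sums of |x|⁻² second
differences, |m| ≤ 14): margin
positive on the whole cell, min +0.050 A/L² at r = (0.1L,0,0) (≈ (15/16)κ|r/L|²), +2.30 at the face
centre, +1.71 at the corner;
pair-count level t_N ≈ t_∞(1 − α/N), α > 0 (favourable, dominant at small r). Second check: raw
PIGS/DMC n₀(N)/N and E/N at fixed
ρa³ = 10⁻⁴…10⁻² versus N (GiorginiBoronatCasulleras1999 and successors): f must DEcrease and E/N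
INcrease with N on periodic boxes.

NUMBERS. Bogoliubov: depletion 1 − n₀/N = (8/(3√π))√(ρa³) + … (LSSY2005 Ch. 5 discussion; DMC
GiorginiBoronatCasulleras1999: universal in ρa³ up
to ~10⁻³), so σ(ρ) can be any number < 1 for small ρ; infrared occupations n_k ≃ mc/(2ħ|k|) (k → 0;
GavoretNozieres1964 for the exact
theory up to the factor n₀/n), hence the T = 0, d = 3 tail γ(r) − ρ₀ ≃ mc/(4π²ħ r²) (subharmonic:
Δr⁻² = 2r⁻⁴), finite-torus
over-condensation n₀(L)/V − ρ₀^∞ = O(1/(ξL²)) (ξ = (8πρa)^{-1/2}); image margins as in § Cheapest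
falsifier; energy-window ceiling of
the in-box methods: window δ > 4π²M²N/L² certifies at most N/(M+1) condensed
(KineticGapLengthScalesNarrow) — all our δ are chosen
AFTER N. Items at open: 6 (3 cruxes, 2 support, 1 assembly).

DEFINITION REQUESTS. None: everything is inlined over
Literature.MathematicalPhysics.QuantumManyBody.BoseGas.{PeriodicTrialState, periodicEnergy,
periodicGroundStateEnergy, cellN, sideLength, condensateOccupation, IsRepulsiveFiniteRange,
HasGroundStateBEC} (lean check rc 0 of
Sketch.lean, 2026-08-15). A convenience notion `translationCorrelation N L Ψ i r := ∫ X in cellN N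
L, conj (Ψ (update X i (X i + r))) * Ψ X`
in PeriodicBoseGas would shorten every signature; not requested, to avoid signature churn on the
shared items. Literature want filed:
acq-03763 (doi:10.1016/j.physleta.2022.128515, finite-size Bogoliubov at T = 0; for the falsifier,
not load-bearing).

Novelty: Searches (2026-08-15): `lit search --hybrid "finite size one-body density matrix periodic box
condensate fraction monotone volume Bose
ground state"` (12 textbook hits: LSSY2005, Pethick–Smith, Krauth 2006, Griffin 1993 — finite-size
lore, no monotonicity statement);
`lit search --source crossref "finite size corrections condensate fraction one-body density matrix
Bose gas periodic boundary
conditions zero temperature"` (14: doi:10.1016/j.physleta.2022.128515 Song 2022 and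
doi:10.1016/j.physleta.2023.129099 — finite-size
Bogoliubov asymptotics, not inequalities; doi:10.1103/physreva.15.2439 Zasada–Pathria 1977 — ideal
gas, boundary conditions);
`--source zbmath` ×2 (0 and 1 irrelevant), `--source arxiv` (0), openalex/s2 HTTP 429; `lit galaxy
search --star all` ×2 (0 rows,
substring), `--star pdf` substring "one-body density matrix" (10, none on volume dependence),
`--star pdf --mode bm25` (12: QMC theses
and finite-size Bose–Hubbard, none with a monotonicity-in-L statement); `lit frontier
AtomisticToContinuum --since 2022` (BEC
descendants arXiv:2603.20776, arXiv:2510.20493, arXiv:2602.16566, arXiv:2605.06844 —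
localisation/energy, none on domain
monotonicity); `lit bridges AtomisticToContinuum --cross any` (no Bose bridge); plus the card's four
refuter audits (4/14/26/29).
Nearest prior art found: MoraCastin2003 and doi:10.1103/PhysRevLett.85.3745 (finite periodic boxes
over-condense at Bogoliubov level,
quasi-condensates); HasenfratzNiedermayer1993 (finite-torus order param  [refs: 10.1016/j.physleta.2022.128515, 10.1016/j.physleta.2023.129099, 10.1103/physreva.15.2439, 10.1103/PhysRevLett.85.3745, 2603.20776, 2510.20493, 2602.16566, 2605.06844, doi:10.1016/j.physleta.2022.128515, doi:10.1016/j.physleta.2023.129099, doi:10.1103/physreva.15.2439, doi:10.1103/PhysRevLett.85.3745, LSSY2005, MoraCastin2003, HasenfratzNiedermayer1993, GiorginiBoronatCasulleras1999, Davies1989, Pu]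

Barriers (technique_class: domain-monotonicity, correlation-inequality, odlro-reduction): - technique_class: domain-monotonicity, correlation-inequality, odlro-reduction
- Literature.Barriers.AtomisticToContinuum.KineticGapLengthScales: evaded — no energy window or
kinetic gap is used; N-uniformity comes from a one-signed comparison between two finite tori and
FixedRangeOrder takes the thermodynamic limit first; the barrier returns only if a prover attacks
FixedRangeOrder by energy localisation in growing boxes.
- Literature.Barriers.AtomisticToContinuum.KineticGapLengthScalesNarrow: evaded — its Galilei-boost
/ phase-modulation witnesses kill ENERGY-WINDOW theorems (δ before N); every δ here is existential
AFTER N and ε (ground-state properties), so the boosted yrast states (energy E₀ + 4π²|m|²N/L²) are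
outside every hypothesis.
- Literature.Barriers.AtomisticToContinuum.EnergyAsymptoticsWithoutCondensation: evaded — no energy
asymptotics enter; t_N ≈ t_∞(1−α/N) is heuristic support for a sign, not an input.
- Literature.Barriers.AtomisticToContinuum.BogoliubovPerturbationInfrared: it does not, for
FixedRangeOrder, if that crux is attacked by expansion around Bogoliubov (d=3 marginal,
Gavoret–Nozières logarithms); the bet is a non-perturbative infinite-volume engine (Palm /
Kipnis–Varadhan / rigidity cards) or a positivity/path argument; for TorusUnfolding Bogoliubov
theory is only heuristic and falsifier — the intended proofs are image identities or path unfolding.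
- Literature.Barriers.AtomisticToContinuum.CasimirBoxGeneralizedCondensation: outside scope — cube

History (route lifecycle, newest last):
- 2026-08-25T01:42:06Z · DORMANT — reconciler: no traction for 7.3 d (last activity item-evidence-added at 2026-08-17T18:55:01Z); parked, not closed — `ledger route dormant route-AtomisticToConti (operator:999:179333)
- 2026-08-29T03:25:54Z · REACTIVATED — reconciler: reactivated — activity statement-checked at 2026-08-29T01:17:37Z after parking at 2026-08-25T01:42:06Z (operator:999:108869)
- 2026-08-29T19:28:32Z · DORMANT — census g0: costume|duplicate of —; reader census-reader-32-g0 (operator:999:972039)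

sub-problem: BoseEinsteinCondensation · status: dormant · opened planner-plancard-AtomisticToContinuum-BoseEin-c777413f-g2-0 2026-08-15T19:00:14Z · rev 1 · ledger route-AtomisticToContinuum-BECPeriodDoubling
GENERATED by the gate from the ledger (D-0016/17). Provers cite these decls: `theorem foo : Summit.AtomisticToContinuum.BoseEinsteinCondensation.Theses.BECPeriodDoubling.<Decl> := …` in Summits/AtomisticToContinuum/BoseEinsteinCondensation/Theorems/<Name>.lean.
-/

namespace Summit.AtomisticToContinuum.BoseEinsteinCondensation.Theses.BECPeriodDoubling

open scoped BigOperators Topology Manifold Classical MeasureTheory ProbabilityTheory Matrix InnerProductSpace ComplexConjugate ContinuousMap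
open Filter Set Function TopologicalSpace MeasureTheory

attribute [summit_statement] _root_.BoseEinsteinCondensation

/-- item stmt-AtomisticToContinuum-13097 · crux · rank 2 · open · by planner
why it might fail: Beyond the quadratic (Bogoliubov) level the occupation of the lowest modes |k|=2π/L (n_k ~ L/ξ) has no proved finite-size sign; an O(1) relative shift there cancels the O(γ₁(L)) image margin at ‖r‖ ~ L/2; 1D hard-rod numerics (N=2,3) reversed it at the antipode.
sources: MoraCastin2003, HasenfratzNiedermayer1993, GavoretNozieres1964, GiorginiBoronatCasulleras1999, Davies1989, PuleZagrebnov2004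
[crux] (card V1, centred cell) for every repulsive finite-range v there is ρ₀>0 such that for
0<ρ<ρ₀, for all large N, for every ε>0 there is δ>0 with: for all δ-near-minimisers Ψ of the
periodic energy on the torus of side L_N=(N/ρ)^{1/3} and Φ on the torus of side L_{8N} = 2L_N, all
particles i, j and every displacement r with |r_k| ≤ L_N/2 (k=1,2,3), Re G_Φ(j,r) ≤ Re G_Ψ(i,r) + ε
(for unique ground states: γ̄_{8N,2L}(r) ≤ γ̄_{N,L}(r) on the closed centred cell). Rank 2: the
line-defining, cheaply testable claim; necessary consequences: kinetic energy per particle t_{8N}(ρ)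
≥ t_N(ρ) eventually (r→0), condensate fraction f_{8N} ≤ f_N (cell average). [difficulty: L] -/
@[route_item "route-AtomisticToContinuum-BECPeriodDoubling", crux]
def TorusUnfolding : Prop :=
  ∀ v : ℝ → ENNReal, Literature.MathematicalPhysics.QuantumManyBody.BoseGas.IsRepulsiveFiniteRange v → ∃ ρ₀ : ℝ, 0 < ρ₀ ∧ ∀ ρ : ℝ, 0 < ρ → ρ < ρ₀ → ∀ᶠ N : ℕ in Filter.atTop, ∀ ε : ℝ, 0 < ε → ∃ δ : ENNReal, 0 < δ ∧ ∀ (Ψ : Literature.MathematicalPhysics.QuantumManyBody.BoseGas.PeriodicTrialState N (Literature.MathematicalPhysics.QuantumManyBody.BoseGas.sideLength ρ N)) (Φ : Literature.MathematicalPhysics.QuantumManyBody.BoseGas.PeriodicTrialState (8 * N) (Literature.MathematicalPhysics.QuantumManyBody.BoseGas.sideLength ρ (8 * N))), Literature.MathematicalPhysics.QuantumManyBody.BoseGas.periodicEnergy v Ψ ≤ Literature.MathematicalPhysics.QuantumManyBody.BoseGas.periodicGroundStateEnergy v N (Literature.MathematicalPhysics.QuantumManyBody.BoseGas.sideLength ρ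 N) + δ → Literature.MathematicalPhysics.QuantumManyBody.BoseGas.periodicEnergy v Φ ≤ Literature.MathematicalPhysics.QuantumManyBody.BoseGas.periodicGroundStateEnergy v (8 * N) (Literature.MathematicalPhysics.QuantumManyBody.BoseGas.sideLength ρ (8 * N)) + δ → ∀ (i : Fin N) (j : Fin (8 * N)) (r : EuclideanSpace ℝ (Fin 3)), (∀ k : Fin 3, |r k| ≤ Literature.MathematicalPhysics.QuantumManyBody.BoseGas.sideLength ρ N / 2) → (∫ X in Literature.MathematicalPhysics.QuantumManyBody.BoseGas.cellN (8 * N) (Literature.MathematicalPhysics.QuantumManyBody.BoseGas.sideLength ρ (8 * N)), conj (Φ.ψ (Function.update X j (X j + r))) * Φ.ψ X).re ≤ (∫ X in Literature.MathematicalPhysics.QuantumManyBody.BoseGas.cellN N (Literature.MathematicalPhysics.QuantumManyBody.BoseGas.sideLength ρ N), conj (Ψ.ψ (Function.update X i (X i + r))) * Ψ.ψ X).re + ε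

/-- item stmt-AtomisticToContinuum-13098 · crux · rank 3 · open · by planner
why it might fail: It is T=0 infinite-volume ODLRO for the interacting continuum gas — open; d=3 is infrared-marginal for any expansion (BogoliubovPerturbationInfrared), no printed method reaches fixed density (KineticGapLengthScales), and σ must serve hard cores and every near-minimiser.
sources: LSSY2005, PenroseOnsager1956, Fournais2020, Junge2026, Literature.Barriers.AtomisticToContinuum.BogoliubovPerturbationInfrared, Literature.Barriers.AtomisticToContinuum.KineticGapLengthScales
[crux] (card V3, typed without the limit state, Euclidean balls) for every repulsive finite-range v
there is ρ₀>0 such that for 0<ρ<ρ₀ there is σ>0 with: for every range R, for all large N (threshold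
depending on R), for every ε>0 there is δ>0 such that every δ-near-minimiser Ψ on the torus of side
L_N satisfies σ ≤ Re G_Ψ(i,r) + ε for all particles i and all r with ‖r‖ ≤ R — off-diagonal
long-range order with the thermodynamic limit taken FIRST, uniformly along the sequence (the
residual open problem in its weakest order of limits; the entry point for the infinite-volume
cards). [difficulty: open-problem] -/
@[route_item "route-AtomisticToContinuum-BECPeriodDoubling", crux]
def FixedRangeOrder : Prop :=
  ∀ v : ℝ → ENNReal, Literature.MathematicalPhysics.QuantumManyBody.BoseGas.IsRepulsiveFiniteRange v → ∃ ρ₀ : ℝ, 0 < ρ₀ ∧ ∀ ρ : ℝ, 0 < ρ → ρ < ρ₀ → ∃ σ : ℝ, 0 < σ ∧ ∀ R : ℝ, ∀ᶠ N : ℕ in Filter.atTop, ∀ ε : ℝ, 0 < ε → ∃ δ : ENNReal, 0 < δ ∧ ∀ Ψ : Literature.MathematicalPhysics.QuantumManyBody.BoseGas.PeriodicTrialState N (Literature.MathematicalPhysics.QuantumManyBody.BoseGas.sideLength ρ N), Literature.MathematicalPhysics.QuantumManyBody.BoseGas.periodicEnergy v Ψ ≤ Literature.MathematicalPhysics.QuantumManyBody.BoseGas.periodicGroundStateEnergy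 v N (Literature.MathematicalPhysics.QuantumManyBody.BoseGas.sideLength ρ N) + δ → ∀ (i : Fin N) (r : EuclideanSpace ℝ (Fin 3)), ‖r‖ ≤ R → σ ≤ (∫ X in Literature.MathematicalPhysics.QuantumManyBody.BoseGas.cellN N (Literature.MathematicalPhysics.QuantumManyBody.BoseGas.sideLength ρ N), conj (Ψ.ψ (Function.update X i (X i + r))) * Ψ.ψ X).re + ε

/-- item stmt-AtomisticToContinuum-0827 · crux · rank 4 · open · by planner
why it might fail: Dirichlet and periodic ground-state energies differ by a wall term ≫ the near-minimiser slack, so no energy-comparison proof; Neumann bracketing must re-localise without re-importing the ℓ⁻² gap; BEC is boundary-condition sensitive (Robinson, Lauwers–Verbeure–Zagrebnov).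
sources: LSSY2005, BoccatoSeiringer2023, Junge2026, LauwersVerbeureZagrebnov2003, arXiv:2603.20776
[crux] BoundaryTransferWeak (mode-free boundary-condition transfer, per potential): for each
repulsive finite-range v, PeriodicBEC(v) implies ∃ρ₀>0 ∀ρ∈(0,ρ₀) HasGroundStateBEC v ρ (Dirichlet
ground state, λ_max(γ) ≥ cN via condensateNumber). Not glue: near-minimiser slacks are O(N/L²) while
Dirichlet/periodic energies differ by a boundary term ≫ N/L², so no energy-comparison proof;
expected route: Neumann bracketing of interior sub-boxes (−Δ_Dir ≥ ⊕−Δ_Neu, v ≥ 0) + a mode-free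
criterion (λ_max ≥ tr γ²/N). Only the ENERGY analogue is in print (LiebSeiringerSolovejYngvason2005
Ch. 2 after (2.8)). v ≡ 0: hypothesis and conclusion both true. -/
@[route_item "route-AtomisticToContinuum-BECPeriodDoubling", crux]
def BoundaryTransferWeak : Prop :=
  ∀ v : ℝ → ENNReal, Literature.MathematicalPhysics.QuantumManyBody.BoseGas.IsRepulsiveFiniteRange v → (∃ ρ₀ : ℝ, 0 < ρ₀ ∧ ∀ ρ : ℝ, 0 < ρ → ρ < ρ₀ → ∃ c : ℝ, 0 < c ∧ ∀ᶠ N : ℕ in Filter.atTop, ∃ δ : ENNReal, 0 < δ ∧ ∀ Ψ : Literature.MathematicalPhysics.QuantumManyBody.BoseGas.PeriodicTrialState N (Literature.MathematicalPhysics.QuantumManyBody.BoseGas.sideLength ρ N), Literature.MathematicalPhysics.QuantumManyBody.BoseGas.periodicEnergy v Ψ ≤ Literature.MathematicalPhysics.QuantumManyBody.BoseGas.periodicGroundStateEnergy v N (Literature.MathematicalPhysics.QuantumManyBody.BoseGas.sideLength ρ N) + δ → ENNReal.ofReal (c * N) ≤ Literature.MathematicalPhysics.QuantumManyBody.BoseGas.condensateOccupation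 N (Literature.MathematicalPhysics.QuantumManyBody.BoseGas.sideLength ρ N) Ψ.ψ) → ∃ ρ₀ : ℝ, 0 < ρ₀ ∧ ∀ ρ : ℝ, 0 < ρ → ρ < ρ₀ → Literature.MathematicalPhysics.QuantumManyBody.BoseGas.HasGroundStateBEC v ρ

/-- item stmt-AtomisticToContinuum-13099 · support · rank 9 · open · by planner
sources: LSSY2005, Fournais2020
[support] for L>0, any N, s and any periodic trial state Ψ of N particles on the torus of side L: a
uniform bound s ≤ Re G_Ψ(i,r) for all particles i and all r in the closed CENTRED cell (|r_k| ≤ L/2)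
gives condensateOccupation N L Ψ ≥ s·N. Proof: n₀ = N·L⁻³∫_{Y∈cell^{N−1}}|∫_{x∈cell}Ψ(x,Y)dx|² =
(N/L³)∫_Y∫_{x∈cell}∫_{x'∈cell} conj Ψ(x',Y)Ψ(x,Y); by Lℤ³-periodicity of Ψ in particle 0 the
x'-integral over the cell equals the integral of conj Ψ(x+r,Y) over r in ANY fundamental domain,
take the centred cell C₀; Fubini gives n₀ = (N/L³)∫_{r∈C₀} G_Ψ(0,r) dr (real), ≥ (N/L³)·L³·s. N = 0
and s ≤ 0 are trivial (ofReal). Positivity of Ψ is NOT needed. [difficulty: M] -/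
@[route_item "route-AtomisticToContinuum-BECPeriodDoubling", crux]
def CellCoherence : Prop :=
  ∀ (N : ℕ) (L s : ℝ), 0 < L → ∀ Ψ : Literature.MathematicalPhysics.QuantumManyBody.BoseGas.PeriodicTrialState N L, (∀ (i : Fin N) (r : EuclideanSpace ℝ (Fin 3)), (∀ k : Fin 3, |r k| ≤ L / 2) → s ≤ (∫ X in Literature.MathematicalPhysics.QuantumManyBody.BoseGas.cellN N L, conj (Ψ.ψ (Function.update X i (X i + r))) * Ψ.ψ X).re) → ENNReal.ofReal (s * N) ≤ Literature.MathematicalPhysics.QuantumManyBody.BoseGas.condensateOccupation N L Ψ.ψ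

/-- item stmt-AtomisticToContinuum-13100 · support · rank 9 · open · by planner
sources: LSSY2005, Fournais2020
[support] TorusUnfolding → FixedRangeOrder → CellCoherence → [PeriodicBEC body, verbatim the
antecedent of BoundaryTransferWeak / the signature of stmt-0826]. Proof (elementary bookkeeping):
fix v, ρ < min(ρ₀^{TU}, ρ₀^{FRO}), σ from FixedRangeOrder, c := σ/2; N ≥ max(N₀(TU),1); R := L_N (≥
(√3/2)L_N, the circumradius of the centred cell); FixedRangeOrder gives N₁(R); levels M₀ := N,
M_{j+1} := 8·M_j (definitional, no casts; sideLength monotone in N by Real.rpow_le_rpow, so the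
centred N-cell lies in every centred M_j-cell); pick k with M_k ≥ N₁; ε' := σ/(2(k+1)); δ* := min of
the k TorusUnfolding δ's (levels M_0…M_{k−1}, tolerance ε') and the FixedRangeOrder δ (level M_k,
ε'); output δ := δ*. For a δ*-near-minimiser Ψ at level N choose δ*-near-minimisers Φ_j at levels j
= 1…k (the constant state inhabits PeriodicTrialState M L for L > 0; iInf_lt_iff if E₀ < ⊤, anything
if E₀ = ⊤); chain Re G_Ψ ≥ Re G_{Φ_k} − kε' ≥ σ − (k+1)ε' = σ/2 on the centred N-cell; CellCoherence
with s = σ/2. [difficulty: M] -/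
@[route_item "route-AtomisticToContinuum-BECPeriodDoubling", crux]
def UnfoldingToPeriodicBEC : Prop :=
  TorusUnfolding → FixedRangeOrder → CellCoherence → ∀ v : ℝ → ENNReal, Literature.MathematicalPhysics.QuantumManyBody.BoseGas.IsRepulsiveFiniteRange v → ∃ ρ₀ : ℝ, 0 < ρ₀ ∧ ∀ ρ : ℝ, 0 < ρ → ρ < ρ₀ → ∃ c : ℝ, 0 < c ∧ ∀ᶠ N : ℕ in Filter.atTop, ∃ δ : ENNReal, 0 < δ ∧ ∀ Ψ : Literature.MathematicalPhysics.QuantumManyBody.BoseGas.PeriodicTrialState N (Literature.MathematicalPhysics.QuantumManyBody.BoseGas.sideLength ρ N), Literature.MathematicalPhysics.QuantumManyBody.BoseGas.periodicEnergy v Ψ ≤ Literature.MathematicalPhysics.QuantumManyBody.BoseGas.periodicGroundStateEnergy v N (Literature.MathematicalPhysics.QuantumManyBody.BoseGas.sideLength ρ N) + δ → ENNReal.ofReal (c * N) ≤ Literature.MathematicalPhysics.QuantumManyBody.BoseGas.condensateOccupation N (Literature.MathematicalPhysics.QuantumManyBody.BoseGas.sideLength ρ N) Ψ.ψ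

/-- item stmt-AtomisticToContinuum-13101 · assembly · rank 1 · open · by planner
sources: LSSY2005, PenroseOnsager1956
[assembly] TorusUnfolding → FixedRangeOrder → CellCoherence → UnfoldingToPeriodicBEC →
BoundaryTransferWeak → BoseEinsteinCondensation. -/
@[route_item "route-AtomisticToContinuum-BECPeriodDoubling"]
def Assembly : Prop :=
  TorusUnfolding → FixedRangeOrder → CellCoherence → UnfoldingToPeriodicBEC → BoundaryTransferWeak → BoseEinsteinCondensation

/-! D-0027 §2.1 — DECIDING THEOREM (planner-authored via `route open/edit --closes-file`; by planner-plancard-AtomisticToContinuum-BoseEin-c777413f-g2-0 2026-08-15T19:00:14Z):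
its hypotheses are this route's items and its conclusion the sub-problem Statement (glue_lint), and it elaborates with this file. -/

@[closes "route-AtomisticToContinuum-BECPeriodDoubling"] theorem closes (h1 : TorusUnfolding) (h2 : FixedRangeOrder) (h3 : CellCoherence) (h4 : UnfoldingToPeriodicBEC) (h5 : BoundaryTransferWeak) : BoseEinsteinCondensation :=
  fun v hv => h5 v hv (h4 h1 h2 h3 v hv)

end Summit.AtomisticToContinuum.BoseEinsteinCondensation.Theses.BECPeriodDoubling
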